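import Summits.QuantumFields.YangMills.Theorems.BalabanUVNodesN14TargetOfBinderAndClassLawTV
import Summits.QuantumFields.YangMills.Theorems.BalabanUVNodesN14ClassLawTiltTransfer

/-!
# DAG node N14 (NE1′) → N19′ ∕ N20 — DRESSING THE CLASS-LAW TV LETTER COSTS ONLY N14's BINDER: the per-set class-law TV at every source `|t| ≤ l₀`
# from the UNDRESSED (`t = 0`) class-law TV + `TiltedMeanMatching` + NE7b's undressed bad weight; with FILE 1 the dressed `∃`-hybrid at a key from
# UNDRESSED TV_cl + N14 + NE7b alone

Cell `pub-ymgap` (HUMAN RULING D-0062, Track A), WIDTH SEAT `pub-ymgap-dag-n14-w2` (NODE n14 = NE1′), generation 6, FILE 2b; `--kind proof --supports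
stmt-QuantumFields-20544 --as helper` (K3⁷; helper, NOT a discharge; count-neutral).  THEOREMS ONLY (0 `def`, 0 `instance`, 0 `sorry`).  Imports this seat's FILE 1
`…N14TargetOfBinderAndClassLawTV` (p612221: `exists_hybridNE7_of_binder_classLawTV`; through it NE1′'s `DressedMGFForm` (`MGFForm`, `TiltedMeanMatching`,
`mgf_eq_mass_mul_exp`, `abs_cgf_sub_sub_le`), node E2's `T4GenFunBounds`, dag-n20-w4's p609004) and FILE 2a `…N14ClassLawTiltTransfer` (the finite-sum tilt
inequalities) ONLY — CITED BY NAME; edits nothing.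

WHY.  FILE 1 showed, in the MGF form the consumer reads (`A K t τ = mgf (F K) (ν K τ) t`), that the TARGET conjunct of dag-n20-w4's characterisation
`(∃ dials, HybridNE7) ⟺ Target ∧ class-law TV` is node N14's binder class-averaged, so the `∃`-hybrid at a key follows from the per-set class-law TV letter
AT EVERY SOURCE `|t| ≤ l₀` + `TiltedMeanMatching η` + NE7b's bad weight.  This file removes the source from the remaining two-run letter: the dressed class
weight is the undressed one TILTED, `A K t τ = A K 0 τ · e^{cgf_τ(t) − cgf_τ(0)}` with tilt factor in `[e^{−l₀B}, e^{l₀B}]` (node E2's MGF bounds), and on a good class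
the two runs' tilt factors agree up to `e^{±η_K|t|}` (NE1′'s `abs_cgf_sub_sub_le` under `TiltedMeanMatching`).  FILE 2a's re-weighting inequalities then give
(§2 ★★ `classLawTV_dressed_of_undressed`)
  `|Σ_S A K t ∕ Σ_T A K t − Σ_S Bf K t ∕ Σ_T Bf K t| ≤ 2e^{2l₀B}·(ρ₀_K + W₀_K) + 2·(e^{l₀η_K} − 1)`   for all `|t| ≤ l₀`, `S ⊆ T K`,
from the UNDRESSED per-set class-law TV `ρ₀_K` (dag-n20-w4's letter at the constant families `fun K _ τ => A K 0 τ`), the UNDRESSED bad weight `W₀_K` (the `bad_left`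
text of `DressedMGFForm.hybridNE7_of_mgfForm`'s undressed datum) and N14's `η_K`; the radius is summable when `ρ₀, W₀, η` are.  Fed into FILE 1 (§3 ★★★): in MGF form the
`∃`-block of K3⁷ v5 stub 2 at a key follows from letters on the UNDRESSED runs (class-law TV, bad weight) and node N14's binder ALONE — the source enters through N14
only.  The CORE-currency precedent is dag-n19-e's `…N19SourceSplit` (`Core ⟺ vacuum half ∧ per-class insertion half`); NE1′'s own `hybridNE7_of_mgfForm` transports
an undressed HYBRID DATUM (it needs the undressed `core` and shells that are MGFs of sub-measures — dag-n20-w4's constructed shells `(A − e^{−c}B)⁺` are not, which is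
why the TV road goes through this file instead).

HONEST FRAMING.  [folklore] finite-sum re-weighting + NE1′'s MGF-form bookkeeping on hypothesis SHAPES; `ρ₀`, `W₀`, `η` are HYPOTHESES produced by nobody (no live
Stage-13 tuple exhibited, K0⁷ OPEN); proves NO estimate of the programme; nothing of Bałaban's asserted or instantiated; NE1′ ∕ NE7 ∕ NE7b NOT PRINTED as two-run
statements for d = 4, NOT proved; N14 ∕ N19 ∕ N20 NOT discharged; K3⁷ OPEN, skeleton v5 untouched; counts UNMOVED.  One finite 𝕋⁴ programme at fixed ε; R4 closes only the
CONDITIONAL finite-𝕋⁴ rung `BalabanLadder.UV` — NOT ℝ⁴, NOT OS, NOT the Yang–Mills mass gap (Clay), which is NOT proved by any of this.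
-/

noncomputable section

open MeasureTheory ProbabilityTheory Finset

namespace YMDAG.N14.ClassLawTVDressingTransfer

open Literature.MathematicalPhysics.QuantumFieldTheory.Balaban1983to89
open Literature.MathematicalPhysics.QuantumFieldTheory.Balaban1983to89.T4MatchingAssembly (HybridNE7)
open Summit.QuantumFields.BalabanUV.T4Continuum.NE1p.DressedMGFForm
open YMDAG.N14.TargetOfBinderAndClassLawTV (exists_hybridNE7_of_binder_classLawTV)
open YMDAG.N14.ClassLawTiltTransfer

/-! ## §2 At the MGF forms: the dressed class weight is the undressed one tilted; the dressed class-law TV letter from undressed letters + N14 -/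

section AtForms

variable {ι : Type*} {Ω Ω' : ℕ → Type*} [∀ K, MeasurableSpace (Ω K)] [∀ K, MeasurableSpace (Ω' K)]
  {l₀ vol B : ℝ} {T : ℕ → Finset ι} {Bad : ℕ → ℝ → Finset ι}
  {F : ∀ K, Ω K → ℝ} {ν : ∀ K, ι → Measure (Ω K)} {F' : ∀ K, Ω' K → ℝ} {ν' : ∀ K, ι → Measure (Ω' K)}
  {A Bf : ℕ → ℝ → ι → ℝ} {η W₀ ρ₀ : ℕ → ℝ} {Z : ℕ → ℝ → ℝ}

/-- **THE DRESSED CLASS WEIGHT IS THE UNDRESSED ONE, TILTED**: `A K t τ = A K 0 τ · e^{cgf_τ(t) − cgf_τ(0)}` (`cgf_τ` the cumulant generating function of the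
observable under run A's class piece `ν K τ`; NE1′'s `mgf_eq_mass_mul_exp`, the zero-measure class included). [folklore] -/
theorem dressed_eq_undressed_mul_exp (hA : MGFForm B T F ν A) (K : ℕ) (t : ℝ) {τ : ι} (hτ : τ ∈ T K) :
    A K t τ = A K 0 τ * Real.exp (cgf (F K) (ν K τ) t - cgf (F K) (ν K τ) 0) := by
  haveI := hA.finite K τ hτ
  rw [hA.repr K t τ hτ, hA.zero_eq K hτ]
  rcases eq_zero_or_neZero (ν K τ) with h0 | hν
  · simp [h0]
  · exact mgf_eq_mass_mul_exp (hA.meas K) (hA.bound K) t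

/-- The tilt factor lies in `[e^{−|t|B}, e^{|t|B}]` (node E2's two-sided MGF bounds; `= 1` on a zero-measure class). [folklore] -/
theorem exp_cgf_sub_mem (hA : MGFForm B T F ν A) (K : ℕ) (t : ℝ) {τ : ι} (hτ : τ ∈ T K) :
    Real.exp (-(|t| * B)) ≤ Real.exp (cgf (F K) (ν K τ) t - cgf (F K) (ν K τ) 0) ∧
      Real.exp (cgf (F K) (ν K τ) t - cgf (F K) (ν K τ) 0) ≤ Real.exp (|t| * B) := by
  haveI := hA.finite K τ hτ
  have htB : 0 ≤ |t| * B := mul_nonneg (abs_nonneg t) hA.nonneg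
  rcases eq_zero_or_neZero (ν K τ) with h0 | hν
  · simp only [h0, cgf_zero_measure, Pi.zero_apply, sub_self, Real.exp_zero]
    exact ⟨Real.exp_le_one_iff.mpr (neg_nonpos.mpr htB), Real.one_le_exp htB⟩
  have hm : 0 < (ν K τ).real Set.univ :=
    ENNReal.toReal_pos (Measure.measure_univ_ne_zero.mpr (NeZero.ne _)) (measure_ne_top _ _)
  have heq := mgf_eq_mass_mul_exp (ν := ν K τ) (hA.meas K) (hA.bound K) t
  have hlo := T4GenFunBounds.exp_neg_le_mgf_of_abs_le (μ := ν K τ) (hA.meas K).aemeasurable (ae_of_all _ (hA.bound K)) t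
  have hhi := T4GenFunBounds.mgf_le_of_abs_le (X := F K) (μ := ν K τ) (ae_of_all _ (hA.bound K)) t
  rw [heq] at hlo hhi
  exact ⟨le_of_mul_le_mul_left hlo hm, le_of_mul_le_mul_left hhi hm⟩

/-- The DRESSED bad weight from the undressed one: `Σ_{Bad K t} A K t ≤ e^{2l₀B}·W₀ K·Σ_{T K} A K t` (cf. NE1′'s `relWeightBound_of_dominated`). [folklore] -/
theorem badWeight_dressed_of_undressed (hA : MGFForm B T F ν A) (hBadT : ∀ (K : ℕ) (t : ℝ), |t| ≤ l₀ → Bad K t ⊆ T K)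
    (hW0 : ∀ (K : ℕ) (t : ℝ), |t| ≤ l₀ → ∑ τ ∈ Bad K t, A K 0 τ ≤ W₀ K * ∑ τ ∈ T K, A K 0 τ) (hZA0 : ∀ K, 0 < ∑ τ ∈ T K, A K 0 τ)
    (K : ℕ) {t : ℝ} (ht : |t| ≤ l₀) : ∑ τ ∈ Bad K t, A K t τ ≤ Real.exp (2 * l₀ * B) * W₀ K * ∑ τ ∈ T K, A K t τ := by
  have hl₀ : 0 ≤ l₀ := (abs_nonneg t).trans ht
  set M := Real.exp (l₀ * B) with hMdef
  have hM : 1 ≤ M := Real.one_le_exp (mul_nonneg hl₀ hA.nonneg)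
  have hMsq : M ^ 2 = Real.exp (2 * l₀ * B) := by rw [hMdef, sq, ← Real.exp_add]; congr 1; ring
  have htB : |t| * B ≤ l₀ * B := mul_le_mul_of_nonneg_right ht hA.nonneg
  set w : ι → ℝ := fun τ => Real.exp (cgf (F K) (ν K τ) t - cgf (F K) (ν K τ) 0)
  have hwlo : ∀ τ ∈ T K, M⁻¹ ≤ w τ := fun τ hτ => by
    rw [hMdef, ← Real.exp_neg]
    exact (Real.exp_le_exp.mpr (by linarith)).trans (exp_cgf_sub_mem hA K t hτ).1
  have hwhi : ∀ τ ∈ T K, w τ ≤ M := fun τ hτ => (exp_cgf_sub_mem hA K t hτ).2.trans (Real.exp_le_exp.mpr htB)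
  have hrwA : ∀ S' ⊆ T K, ∑ τ ∈ S', A K t τ = ∑ τ ∈ S', A K 0 τ * w τ := fun S' hS' =>
    Finset.sum_congr rfl fun τ hτ => dressed_eq_undressed_mul_exp hA K t (hS' hτ)
  rw [hrwA _ (hBadT K t ht), hrwA _ (Finset.Subset.refl _), ← hMsq]
  exact tilted_bad_le hM (fun τ hτ => hA.zero_nonneg K hτ) (hZA0 K) (hBadT K t ht) (hW0 K t ht) hwlo hwhi

/-- The DRESSED totals are positive when the undressed ones are. [folklore] -/
theorem sum_dressed_pos (hA : MGFForm B T F ν A) (hZA0 : ∀ K, 0 < ∑ τ ∈ T K, A K 0 τ) (K : ℕ) (t : ℝ) :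
    0 < ∑ τ ∈ T K, A K t τ := by
  set M := Real.exp (|t| * B) with hMdef
  have hM : 1 ≤ M := Real.one_le_exp (mul_nonneg (abs_nonneg t) hA.nonneg)
  rw [Finset.sum_congr rfl fun τ hτ => dressed_eq_undressed_mul_exp hA K t hτ]
  exact tilted_total_pos hM (fun τ hτ => hA.zero_nonneg K hτ) (hZA0 K) fun τ hτ => by
    rw [hMdef, ← Real.exp_neg]; exact (exp_cgf_sub_mem hA K t hτ).1

/-- The dressed radius is summable when `ρ₀`, `W₀`, `η` are (`e^{l₀η_K} − 1 ≤ 2·l₀η_K` eventually, Mathlib `Real.abs_exp_sub_one_le`). [folklore] -/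
theorem summable_dressedRadius (hl₀ : 0 ≤ l₀) (hρ0s : Summable ρ₀) (hW0s : Summable W₀) (hηs : Summable η) (hη0 : ∀ K, 0 ≤ η K) :
    Summable fun K => 2 * Real.exp (2 * l₀ * B) * (ρ₀ K + W₀ K) + 2 * (Real.exp (l₀ * η K) - 1) := by
  refine ((hρ0s.add hW0s).mul_left _).add (Summable.mul_left 2 ?_)
  have hsmall : ∀ᶠ K in Filter.atTop, |l₀ * η K| ≤ 1 := by
    have h : Filter.Tendsto (fun K => l₀ * η K) Filter.atTop (nhds 0) := by
      simpa using hηs.tendsto_atTop_zero.const_mul l₀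
    obtain ⟨N, hN⟩ := Metric.tendsto_atTop.mp h 1 one_pos
    exact Filter.eventually_atTop.mpr ⟨N, fun K hK => by simpa [Real.dist_eq] using (hN K hK).le⟩
  refine Summable.of_norm_bounded_eventually_nat ((hηs.mul_left l₀).mul_left 2) (hsmall.mono fun K hK => ?_)
  rw [Real.norm_eq_abs]
  calc |Real.exp (l₀ * η K) - 1| ≤ 2 * |l₀ * η K| := Real.abs_exp_sub_one_le hK
    _ = 2 * (l₀ * η K) := by rw [abs_of_nonneg (mul_nonneg hl₀ (hη0 K))]

variable [DecidableEq ι]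

/-- **ON A GOOD CLASS THE TWO RUNS' TILT FACTORS AGREE UP TO `e^{±η_K·|t|}`**: under N14's `TiltedMeanMatching η`, for `|t| ≤ l₀` and `τ ∈ T K ∖ Bad K t`,
`|w′_τ − w_τ| ≤ (e^{l₀·η_K} − 1)·w_τ` (NE1′'s `abs_cgf_sub_sub_le` BY NAME). [folklore] -/
theorem abs_exp_cgf_sub_sub_le (hA : MGFForm B T F ν A) (hB : MGFForm B T F' ν' Bf) (hη : TiltedMeanMatching l₀ T Bad F ν F' ν' η)
    (hη0 : ∀ K, 0 ≤ η K) (K : ℕ) {t : ℝ} (ht : |t| ≤ l₀) {τ : ι} (hτ : τ ∈ T K \ Bad K t) :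
    |Real.exp (cgf (F' K) (ν' K τ) t - cgf (F' K) (ν' K τ) 0) - Real.exp (cgf (F K) (ν K τ) t - cgf (F K) (ν K τ) 0)|
      ≤ (Real.exp (l₀ * η K) - 1) * Real.exp (cgf (F K) (ν K τ) t - cgf (F K) (ν K τ) 0) := by
  have hτT : τ ∈ T K := (Finset.mem_sdiff.mp hτ).1
  haveI := hA.finite K τ hτT; haveI := hB.finite K τ hτT
  set g := cgf (F K) (ν K τ) t - cgf (F K) (ν K τ) 0
  set g' := cgf (F' K) (ν' K τ) t - cgf (F' K) (ν' K τ) 0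
  have hgg : |g' - g| ≤ η K * |t| :=
    abs_cgf_sub_sub_le (hA.meas K) (hA.bound K) (hB.meas K) (hB.bound K) (fun s hs => hη K t ht τ hτ s hs) ht
  have hgg' : |g' - g| ≤ l₀ * η K := hgg.trans (by rw [mul_comm]; exact mul_le_mul_of_nonneg_right ht (hη0 K))
  have hfac : Real.exp g' - Real.exp g = (Real.exp (g' - g) - 1) * Real.exp g := by
    rw [sub_mul, ← Real.exp_add, sub_add_cancel, one_mul]
  -- `|e^x − 1| ≤ e^c − 1` for `|x| ≤ c` (the negative side by `e^c + e^{−c} ≥ 2`), inlined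
  have hexp : |Real.exp (g' - g) - 1| ≤ Real.exp (l₀ * η K) - 1 := by
    obtain ⟨hlo, hhi⟩ := abs_le.mp hgg'
    refine abs_le.mpr ⟨?_, by linarith [Real.exp_le_exp.mpr hhi]⟩
    have h1 : Real.exp (-(l₀ * η K)) ≤ Real.exp (g' - g) := Real.exp_le_exp.mpr (by linarith)
    have h2 : Real.exp (l₀ * η K) * Real.exp (-(l₀ * η K)) = 1 := by rw [← Real.exp_add, add_neg_cancel, Real.exp_zero]
    nlinarith [sq_nonneg (Real.exp (l₀ * η K) - 1), Real.exp_pos (l₀ * η K), Real.exp_pos (-(l₀ * η K))]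
  calc |Real.exp g' - Real.exp g| = |Real.exp (g' - g) - 1| * Real.exp g := by
        rw [hfac, abs_mul, abs_of_pos (Real.exp_pos g)]
    _ ≤ (Real.exp (l₀ * η K) - 1) * Real.exp g := mul_le_mul_of_nonneg_right hexp (Real.exp_pos g).le

/-- ★★ **DRESSING THE CLASS-LAW TV LETTER COSTS ONLY N14's BINDER.**  MGF forms for the two runs on one class family; N14's `TiltedMeanMatching η` (`0 ≤ η`);
the UNDRESSED bad weight `Σ_{Bad K t} A K 0 ≤ W₀ K·Σ_{T K} A K 0` (the `bad_left` text of `DressedMGFForm.hybridNE7_of_mgfForm`'s undressed datum); dag-n20-w4's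
per-set class-law TV letter for the UNDRESSED class laws (`t = 0`, radius `ρ₀ K`); positivity of the undressed totals.  THEN at every source `|t| ≤ l₀` and every
`S ⊆ T K` the DRESSED class laws satisfy dag-n20-w4's letter with radius `2e^{2l₀B}·(ρ₀ K + W₀ K) + 2·(e^{l₀η_K} − 1)`. [folklore] -/
theorem classLawTV_dressed_of_undressed (hA : MGFForm B T F ν A) (hB : MGFForm B T F' ν' Bf)
    (hη : TiltedMeanMatching l₀ T Bad F ν F' ν' η) (hη0 : ∀ K, 0 ≤ η K) (hBadT : ∀ (K : ℕ) (t : ℝ), |t| ≤ l₀ → Bad K t ⊆ T K)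
    (hW0 : ∀ (K : ℕ) (t : ℝ), |t| ≤ l₀ → ∑ τ ∈ Bad K t, A K 0 τ ≤ W₀ K * ∑ τ ∈ T K, A K 0 τ)
    (hρ0 : ∀ (K : ℕ), ∀ S ⊆ T K,
      |(∑ τ ∈ S, A K 0 τ) / (∑ τ ∈ T K, A K 0 τ) - (∑ τ ∈ S, Bf K 0 τ) / (∑ τ ∈ T K, Bf K 0 τ)| ≤ ρ₀ K)
    (hZA0 : ∀ K, 0 < ∑ τ ∈ T K, A K 0 τ) (hZB0 : ∀ K, 0 < ∑ τ ∈ T K, Bf K 0 τ) (K : ℕ) {t : ℝ} (ht : |t| ≤ l₀)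
    {S : Finset ι} (hS : S ⊆ T K) :
    |(∑ τ ∈ S, A K t τ) / (∑ τ ∈ T K, A K t τ) - (∑ τ ∈ S, Bf K t τ) / (∑ τ ∈ T K, Bf K t τ)|
      ≤ 2 * Real.exp (2 * l₀ * B) * (ρ₀ K + W₀ K) + 2 * (Real.exp (l₀ * η K) - 1) := by
  have hl₀ : 0 ≤ l₀ := (abs_nonneg t).trans ht
  set M := Real.exp (l₀ * B) with hMdef
  have hM : 1 ≤ M := Real.one_le_exp (mul_nonneg hl₀ hA.nonneg)
  have hMsq : M ^ 2 = Real.exp (2 * l₀ * B) := by rw [hMdef, sq, ← Real.exp_add]; congr 1; ring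
  set w : ι → ℝ := fun τ => Real.exp (cgf (F K) (ν K τ) t - cgf (F K) (ν K τ) 0)
  set w' : ι → ℝ := fun τ => Real.exp (cgf (F' K) (ν' K τ) t - cgf (F' K) (ν' K τ) 0)
  have htB : |t| * B ≤ l₀ * B := mul_le_mul_of_nonneg_right ht hA.nonneg
  have hwlo : ∀ τ ∈ T K, M⁻¹ ≤ w τ := fun τ hτ => by
    rw [hMdef, ← Real.exp_neg]
    exact (Real.exp_le_exp.mpr (by linarith)).trans (exp_cgf_sub_mem hA K t hτ).1
  have hwhi : ∀ τ ∈ T K, w τ ≤ M := fun τ hτ => (exp_cgf_sub_mem hA K t hτ).2.trans (Real.exp_le_exp.mpr htB)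
  have hwlo' : ∀ τ ∈ T K, M⁻¹ ≤ w' τ := fun τ hτ => by
    rw [hMdef, ← Real.exp_neg]
    exact (Real.exp_le_exp.mpr (by linarith)).trans (exp_cgf_sub_mem hB K t hτ).1
  have hwhi' : ∀ τ ∈ T K, w' τ ≤ M := fun τ hτ => (exp_cgf_sub_mem hB K t hτ).2.trans (Real.exp_le_exp.mpr htB)
  have hrwA : ∀ S' ⊆ T K, ∑ τ ∈ S', A K t τ = ∑ τ ∈ S', A K 0 τ * w τ := fun S' hS' =>
    Finset.sum_congr rfl fun τ hτ => dressed_eq_undressed_mul_exp hA K t (hS' hτ)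
  have hrwB : ∀ S' ⊆ T K, ∑ τ ∈ S', Bf K t τ = ∑ τ ∈ S', Bf K 0 τ * w' τ := fun S' hS' =>
    Finset.sum_congr rfl fun τ hτ => dressed_eq_undressed_mul_exp hB K t (hS' hτ)
  rw [hrwA S hS, hrwA (T K) (Finset.Subset.refl _), hrwB S hS, hrwB (T K) (Finset.Subset.refl _), ← hMsq]
  have hκ : 0 ≤ Real.exp (l₀ * η K) - 1 := by linarith [Real.one_le_exp (mul_nonneg hl₀ (hη0 K))]
  refine (abs_tilted_sub_tilted_le (κ := Real.exp (l₀ * η K) - 1) hM (fun τ hτ => hA.zero_nonneg K hτ)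
    (fun τ hτ => hB.zero_nonneg K hτ) (hZA0 K) (hZB0 K) (hBadT K t ht) (hW0 K t ht) hwlo hwhi hwlo' hwhi' hκ
    (fun τ hτ => abs_exp_cgf_sub_sub_le hA hB hη hη0 K ht hτ) (hρ0 K) hS).trans (le_of_eq ?_)
  ring

/-! ## §3 The dressed `∃`-hybrid at a key from UNDRESSED class-law letters and N14's binder alone (FILE 1 BY NAME) -/

/-- ★★★ **IN MGF FORM THE SOURCE ENTERS STUB 2's `∃`-BLOCK THROUGH NODE N14's BINDER ONLY.**  Two MGF-form runs on one class family; N14's `TiltedMeanMatching η`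
(Σ η < ∞); on the UNDRESSED runs (`t = 0`): the bad weight `W₀` of the (source-indexed) bad classes (Σ W₀ < ∞), dag-n20-w4's per-set class-law TV radius `ρ₀`
(Σ ρ₀ < ∞), positivity; the smallness `2e^{2l₀B}(ρ₀ K + W₀ K) + 2(e^{l₀η_K} − 1) < 1` of the dressed radius; the dictionary for the DRESSED partition functions.  THEN
`∃ shA shB, HybridNE7 l₀ vol T A Bf ∅ 0 shA shB ρ δ` for the DRESSED runs at every `|t| ≤ l₀` — FILE 1's `exists_hybridNE7_of_binder_classLawTV` (hence dag-n20-w4's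
`exists_hybridNE7_of_target_of_classLawTV`) fed by §2.  No core ∕ mass ∕ variance ∕ response letter; no dressed two-run letter other than N14's. [folklore] -/
theorem exists_hybridNE7_dressed_of_undressed (hl₀ : 0 ≤ l₀) (hvol : 0 < vol) (hA : MGFForm B T F ν A) (hB : MGFForm B T F' ν' Bf)
    (hη : TiltedMeanMatching l₀ T Bad F ν F' ν' η) (hη0 : ∀ K, 0 ≤ η K) (hηs : Summable η)
    (hBadT : ∀ (K : ℕ) (t : ℝ), |t| ≤ l₀ → Bad K t ⊆ T K)
    (hW0 : ∀ (K : ℕ) (t : ℝ), |t| ≤ l₀ → ∑ τ ∈ Bad K t, A K 0 τ ≤ W₀ K * ∑ τ ∈ T K, A K 0 τ) (hW0s : Summable W₀)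
    (hρ0 : ∀ (K : ℕ), ∀ S ⊆ T K,
      |(∑ τ ∈ S, A K 0 τ) / (∑ τ ∈ T K, A K 0 τ) - (∑ τ ∈ S, Bf K 0 τ) / (∑ τ ∈ T K, Bf K 0 τ)| ≤ ρ₀ K) (hρ0s : Summable ρ₀)
    (hsmall : ∀ K, 2 * Real.exp (2 * l₀ * B) * (ρ₀ K + W₀ K) + 2 * (Real.exp (l₀ * η K) - 1) < 1)
    (hZA0 : ∀ K, 0 < ∑ τ ∈ T K, A K 0 τ) (hZB0 : ∀ K, 0 < ∑ τ ∈ T K, Bf K 0 τ)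
    (hZA' : ∀ (K : ℕ) (t : ℝ), |t| ≤ l₀ → Z K t = ∑ τ ∈ T K, A K t τ)
    (hZB' : ∀ (K : ℕ) (t : ℝ), |t| ≤ l₀ → Z (K + 1) t = ∑ τ ∈ T K, Bf K t τ) :
    ∃ shA shB : ℕ → ℝ → ι → ℝ,
      HybridNE7 l₀ vol T A Bf (fun _ _ => ∅) (fun _ => 0) shA shB
        (fun K => 2 * Real.exp (2 * l₀ * B) * (ρ₀ K + W₀ K) + 2 * (Real.exp (l₀ * η K) - 1))
        (fun K => l₀ * (η K + 2 * B * (Real.exp (2 * l₀ * B) * W₀ K)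
          + 2 * B * (2 * Real.exp (2 * l₀ * B) * (ρ₀ K + W₀ K) + 2 * (Real.exp (l₀ * η K) - 1))) / vol) := by
  have hρd := fun K t ht S hS => classLawTV_dressed_of_undressed hA hB hη hη0 hBadT hW0 hρ0 hZA0 hZB0 K (t := t) ht (S := S) hS
  refine exists_hybridNE7_of_binder_classLawTV hA hB hη hη0 hBadT
    (fun K t ht => badWeight_dressed_of_undressed hA hBadT hW0 hZA0 K ht) hρd
    (fun K t _ => sum_dressed_pos hA hZA0 K t) (fun K t _ => sum_dressed_pos hB hZB0 K t) hl₀ hvol hηs (hW0s.mul_left _)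
    (fun K => ?_) hsmall (summable_dressedRadius hl₀ hρ0s hW0s hηs hη0) hZA' hZB'
  have h := hρd K 0 (by rw [abs_zero]; exact hl₀) ∅ (Finset.empty_subset _)
  simp only [Finset.sum_empty, zero_div, sub_zero, abs_zero] at h
  exact h

end AtForms


end YMDAG.N14.ClassLawTVDressingTransfer

end
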